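import Summits.ValiantsHypothesis.ValiantsHypothesis.Theses.FreeSubtorus
import Literature.Computability.AlgebraicComplexity.GrenetEquivariant
import Literature.Computability.AlgebraicComplexity.FermionicPencil

/-!
# `FreeSubtorus.SubtorusCovering` (stmt-ValiantsHypothesis-16134): affineness of the entries is load-bearing

Negative knowledge for the crux (standing disprover, cycle 1, 2026-08-17), inline statement, no new facts:
with the degree bound `totalDegree ≤ 1` removed from `IsEquivariantDetRepr` (determinantal EXPRESSIONS of any
degree, exact `GL_m × GL_m` lifts kept), the covering bound `C(n,⌊n/2⌋) ≤ m · 2^r` is FALSE: the `1 × 1`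
matrix `(per_n)` has exact lifts of the whole row–column torus (`g = ∏d·∏e`, `h = 1`, from the
semi-invariance `per(d_k e_l x_{kl}) = ∏d ∏e · per(x)`), so it is `T_Λ`-equivariant for every `Λ`, of size
`1 < 3 = C(3,1)`.  The covering count is a statement about degree-one labels (paths of length `n`).
-/

open Literature.Computability.AlgebraicComplexity MvPolynomial Matrix

noncomputable section

namespace Summit.ValiantsHypothesis.Theorems.SubtorusCoveringNegative.Affine

/-- Semi-invariance of the permanent under the row–column torus:
`per(d_k e_l x_{kl}) = (∏ d)(∏ e) · per(x)`. [folklore] -/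
theorem linSubst_torus_perPoly {n : ℕ} (d e : Fin n → ℂˣ) :
    linSubst (Fin n × Fin n) ℂ (Matrix.diagonal fun p : Fin n × Fin n => (d p.1 : ℂ) * (e p.2 : ℂ))
      (perPoly (Fin n) ℂ) = C ((∏ k, (d k : ℂ)) * ∏ l, (e l : ℂ)) * perPoly (Fin n) ℂ := by
  rw [perPoly_eq_sum, map_sum, Finset.mul_sum]
  refine Finset.sum_congr rfl fun σ _ => ?_
  rw [map_prod]
  simp_rw [Grenet.linSubst_diagonal_X, MvPolynomial.smul_eq_C_mul, Finset.prod_mul_distrib, ← map_prod]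
  congr 2
  rw [Finset.prod_mul_distrib]
  congr 1
  exact Equiv.prod_comp σ (fun k => (d k : ℂ))

/-- Exact lifts compose: lifts on a generating set give lifts on the generated subgroup (the closure
induction of `IsEquivariantDetRepr.of_generators`, which does not use its affine conjunct).
[cite: LandsbergRessayre2017, Def. 1.3] -/
theorem lifts_of_generators {n m : ℕ} {S : Set (GL (Fin n × Fin n) ℂ)}
    (A : Matrix (Fin m) (Fin m) (MvPolynomial (Fin n × Fin n) ℂ))
    (hS : ∀ γ ∈ S, ∃ g h : GL (Fin m) ℂ,
      Matrix.linSubstEntries γ A =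
        (g : Matrix (Fin m) (Fin m) ℂ).map C * A * ((h⁻¹ : GL (Fin m) ℂ) : Matrix (Fin m) (Fin m) ℂ).map C) :
    ∀ γ ∈ Subgroup.closure S, ∃ g h : GL (Fin m) ℂ,
      Matrix.linSubstEntries γ A =
        (g : Matrix (Fin m) (Fin m) ℂ).map C * A * ((h⁻¹ : GL (Fin m) ℂ) : Matrix (Fin m) (Fin m) ℂ).map C := by
  intro γ hγ
  induction hγ using Subgroup.closure_induction with
  | mem x hx => exact hS x hx
  | one =>
    refine ⟨1, 1, ?_⟩
    simp [Matrix.map_one C C_0 C_1]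
  | mul x y _ _ hx hy =>
    obtain ⟨g₁, h₁, h1⟩ := hx
    obtain ⟨g₂, h₂, h2⟩ := hy
    refine ⟨g₂ * g₁, h₂ * h₁, ?_⟩
    rw [← Matrix.linSubstEntries_linSubstEntries, h2, Matrix.linSubstEntries_mul,
      Matrix.linSubstEntries_mul, Matrix.linSubstEntries_map_C, Matrix.linSubstEntries_map_C, h1,
      _root_.mul_inv_rev, Units.val_mul, Units.val_mul, Matrix.map_mul, Matrix.map_mul]
    simp only [Matrix.mul_assoc]
  | inv x _ hx =>
    obtain ⟨g, h, h1⟩ := hx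
    refine ⟨g⁻¹, h⁻¹, ?_⟩
    have key : A = (g : Matrix (Fin m) (Fin m) ℂ).map C * Matrix.linSubstEntries x⁻¹ A *
        ((h⁻¹ : GL (Fin m) ℂ) : Matrix (Fin m) (Fin m) ℂ).map C := by
      have := congrArg (Matrix.linSubstEntries x⁻¹) h1
      rwa [Matrix.linSubstEntries_inv_linSubstEntries, Matrix.linSubstEntries_mul,
        Matrix.linSubstEntries_mul, Matrix.linSubstEntries_map_C, Matrix.linSubstEntries_map_C] at this
    rw [inv_inv]
    have hGL : ∀ u : GL (Fin m) ℂ, ((u⁻¹ : GL (Fin m) ℂ) : Matrix (Fin m) (Fin m) ℂ).map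
        (C : ℂ →+* MvPolynomial (Fin n × Fin n) ℂ) *
        (u : Matrix (Fin m) (Fin m) ℂ).map (C : ℂ →+* MvPolynomial (Fin n × Fin n) ℂ) = 1 :=
      fun u => by
        rw [← Matrix.map_mul, ← Units.val_mul, inv_mul_cancel, Units.val_one, Matrix.map_one C C_0 C_1]
    have hg := hGL g
    have hh := hGL h
    calc Matrix.linSubstEntries x⁻¹ A
        = (((g⁻¹ : GL (Fin m) ℂ) : Matrix (Fin m) (Fin m) ℂ).map C * (g : Matrix (Fin m) (Fin m) ℂ).map C) *
            Matrix.linSubstEntries x⁻¹ A * (((h⁻¹ : GL (Fin m) ℂ) : Matrix (Fin m) (Fin m) ℂ).map C *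
              (h : Matrix (Fin m) (Fin m) ℂ).map C) := by rw [hg, hh, Matrix.one_mul, Matrix.mul_one]
      _ = ((g⁻¹ : GL (Fin m) ℂ) : Matrix (Fin m) (Fin m) ℂ).map C * ((g : Matrix (Fin m) (Fin m) ℂ).map C *
            Matrix.linSubstEntries x⁻¹ A * ((h⁻¹ : GL (Fin m) ℂ) : Matrix (Fin m) (Fin m) ℂ).map C) *
            (h : Matrix (Fin m) (Fin m) ℂ).map C := by simp only [Matrix.mul_assoc]
      _ = ((g⁻¹ : GL (Fin m) ℂ) : Matrix (Fin m) (Fin m) ℂ).map C * A * (h : Matrix (Fin m) (Fin m) ℂ).map C := by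
          rw [← key]

/-- `(per_n)` (as a `1 × 1` matrix) has exact lifts of every subtorus `T_Λ` (in fact of the whole
row–column torus): `g = (∏ d ∏ e)`, `h = 1`. [folklore] -/
theorem perOne_lifts (n r : ℕ) (Λ : Fin r → (Fin n ⊕ Fin n) → ℤ) :
    ∀ γ ∈ Subgroup.closure {γ : Matrix.GeneralLinearGroup (Fin n × Fin n) ℂ |
          ∃ d e : Fin n → ℂˣ, (∀ i, (∏ k, (d k) ^ (Λ i (Sum.inl k))) * (∏ l, (e l) ^ (Λ i (Sum.inr l))) = 1) ∧
            (γ : Matrix (Fin n × Fin n) (Fin n × Fin n) ℂ) =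
              Matrix.diagonal (fun p => (d p.1 : ℂ) * (e p.2 : ℂ))},
      ∃ g h : GL (Fin 1) ℂ,
        Matrix.linSubstEntries γ (Matrix.of fun _ _ => perPoly (Fin n) ℂ : Matrix (Fin 1) (Fin 1) _) =
          (g : Matrix (Fin 1) (Fin 1) ℂ).map C * (Matrix.of fun _ _ => perPoly (Fin n) ℂ) *
            ((h⁻¹ : GL (Fin 1) ℂ) : Matrix (Fin 1) (Fin 1) ℂ).map C := by
  refine lifts_of_generators _ ?_
  rintro γ ⟨d, e, -, hγ⟩
  have hc : (∏ k, (d k : ℂ)) * ∏ l, (e l : ℂ) ≠ 0 :=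
    mul_ne_zero (Finset.prod_ne_zero_iff.2 fun k _ => (d k).ne_zero)
      (Finset.prod_ne_zero_iff.2 fun l _ => (e l).ne_zero)
  refine ⟨Grenet.diagUnit (fun _ => (∏ k, (d k : ℂ)) * ∏ l, (e l : ℂ)) (fun _ => hc), 1, ?_⟩
  refine Matrix.ext fun i j => ?_
  rw [Matrix.linSubstEntries_apply, hγ, Matrix.of_apply, linSubst_torus_perPoly]
  fin_cases i; fin_cases j
  simp [Matrix.map_one C C_0 C_1, Matrix.mul_apply]

/-- **Affineness is load-bearing:** `SubtorusCovering` with `totalDegree ≤ 1` dropped (only `det B = per_n`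
and the exact lifts kept) is FALSE — witness `n = 3`, `m = 1`, `r = 0`, `B = (per_3)`: `C(3,1) = 3 > 1`.
[folklore] -/
theorem subtorusCovering_false_without_affine :
    ¬ ∀ n : ℕ, 3 ≤ n → ∀ (m r : ℕ) (Λ : Fin r → (Fin n ⊕ Fin n) → ℤ)
        (B : Matrix (Fin m) (Fin m) (MvPolynomial (Fin n × Fin n) ℂ)),
        (∀ i, (∑ k, Λ i (Sum.inl k)) = 0 ∧ (∑ l, Λ i (Sum.inr l)) = 0) →
        (B.det = perPoly (Fin n) ℂ ∧
          ∀ γ ∈ Subgroup.closure {γ : Matrix.GeneralLinearGroup (Fin n × Fin n) ℂ |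
              ∃ d e : Fin n → ℂˣ,
                (∀ i, (∏ k, (d k) ^ (Λ i (Sum.inl k))) * (∏ l, (e l) ^ (Λ i (Sum.inr l))) = 1) ∧
                (γ : Matrix (Fin n × Fin n) (Fin n × Fin n) ℂ) =
                  Matrix.diagonal (fun p => (d p.1 : ℂ) * (e p.2 : ℂ))},
            ∃ g h : GL (Fin m) ℂ, Matrix.linSubstEntries γ B =
              (g : Matrix (Fin m) (Fin m) ℂ).map C * B * ((h⁻¹ : GL (Fin m) ℂ) : Matrix (Fin m) (Fin m) ℂ).map C) →
        Nat.choose n (n / 2) ≤ m * 2 ^ r := by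
  intro h
  have key := h 3 le_rfl 1 0 (fun i => Fin.elim0 i) (Matrix.of fun _ _ => perPoly (Fin 3) ℂ)
    (fun i => Fin.elim0 i) ⟨by simp [Matrix.det_unique], perOne_lifts 3 0 _⟩
  simp at key

end Summit.ValiantsHypothesis.Theorems.SubtorusCoveringNegative.Affine

end
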